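import Summits.QuantumAdvantage.QuantumAdvantage.Theorems.NearExactIsExact.Negative.FifteenSixteenths
import Summits.QuantumAdvantage.QuantumAdvantage.Theorems.CubicForrelationNearExactIsExactRmWeight
import Summits.QuantumAdvantage.QuantumAdvantage.Theorems.CubicForrelationNearExactIsExactDerivDegree
import Summits.QuantumAdvantage.QuantumAdvantage.Theorems.CubicForrelationNearExactIsExactMmFormCeilingA

/-!
# `NearExactIsExact` (stmt-QuantumAdvantage-14043), negative side — the THREE-QUARTERS LEMMA behind the
# cubic-part separation criterion

B2b disprover cell, generation 31 (`b2b-cforr-disprove-g31`).  HONEST FRAMING: a small kernel-checked inequality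
([folklore] ingredients: the Reed–Muller minimum distance `d(RM(3,m)) = 2^{m-3}`, applied to a word AND to its complement);
it is the load-bearing step of the seat's census of the habitat `H(3,8;14)` (`DISPROOF.md` §39: the cubic classes
b, c, d, e of 8-variable slices never give a forrelation in `(7/8, 1)` against ANY cubic partner); it is NOT summit
progress and produces no value above the `n = 14` record `57/64`.

**The lemma.**  If `e : 𝔽₂^m → 𝔽₂` has algebraic degree EXACTLY three in the weak sense `IsDegLeFun 3 e ∧ ¬ IsDegLeFun 2 e`,
then both `e` and `¬e` are non-zero words of `RM(3,m)`, so `2^m ≤ 8·#{e = 1}` and `2^m ≤ 8·#{e = 0}`, i.e. the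
character sum `Σ_c (-1)^{e(c)} = 2^m − 2·#{e = 1}` satisfies `4·|Σ_c (-1)^{e(c)}| ≤ 3·2^m` (`abs_sum_signOf_le`: the tree's
`fc_bias` — which takes the Reed–Muller bound as a hypothesis — discharged by the landed `stub_rmWeight stub_derivDegree`).

**Use (the separation criterion).**  Let a slice `G_u` of a relabeled fibre family be bent with dual `d`,
`W_{G_u}(c) = A·(-1)^{d(c)}` (`A = 2^{m/2}`), and let `p` be a `c`-slice of the (cubic) modified partner `f′` of
`Negative.ShapeLemma.fsum_eq_fibreSigned`.  If the cubic parts of `p` and `d` differ, `p ⊕ d` has degree exactly `3` and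
`corr_le_three_quarters` gives `4·Σ_c (-1)^{p(c)} W_{G_u}(c) ≤ 3·A·2^m` — the slice contributes at most `3/4` of a
perfectly matched bent slice; `fibreSum_corr_le` is the same bound summed over the `2^s` fibres `b`.  Since all `c`-slices
of one cubic `f′` share ONE cubic part, at most the bent slices whose duals have that cubic part can be matched beyond `3/4`;
in `H(3,8;14)` a value `> 7/8` needs five such slices, which (by the exhaustive dual-cubic-part data of §39.3) forces all
eight slices bent, i.e. the bent branch (`Φ = 1` or `Φ ≤ 7/8`, THEOREM BENT14).  That counting is arithmetic on paper;
this file certifies the inequality it rests on.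

References: F. J. MacWilliams, N. J. A. Sloane, The Theory of Error-Correcting Codes (1977) Ch. 13 Thm 3 (minimum weight of
`RM(r,m)`); C. Carlet, Boolean Functions for Cryptography and Coding Theory (CUP 2021) §2.2 (algebraic degree), §6.1 (duals
of bent functions); S. Aaronson, A. Ambainis, Forrelation, SIAM J. Comput. 47 (2018) §1.1.1.  Everything below is proved;
standard axioms only.
-/

set_option linter.dupNamespace false -- D-0017: single-problem summit ⇒ `QuantumAdvantage.QuantumAdvantage` by design

namespace Summit.QuantumAdvantage.QuantumAdvantage.Theorems.NearExactIsExact.Negative.CubicPartSeparation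

open Finset
open Literature.Computability.QuantumComplexity
open Summit.QuantumAdvantage.QuantumAdvantage.Theorems.CubicForrelation.NearExactIsExact
  (stub_derivDegree stub_rmWeight fc_bias fc_sum_signOf_eq_card)
open Summit.QuantumAdvantage.QuantumAdvantage.Theorems.NearExactIsExact.Negative (IsDegLeFun.bnot')

variable {m : ℕ}

/-! ### The character sum of an exact-degree-three word -/

/-- **Three-quarters lemma.** For an exact-degree-three word, `4·|Σ_c (-1)^{e(c)}| ≤ 3·2^m`. [folklore] -/
theorem abs_sum_signOf_le (e : (Fin m → Bool) → Bool) (h3 : IsDegLeFun 3 e) (hn2 : ¬ IsDegLeFun 2 e) :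
    4 * |∑ x, signOf (e x)| ≤ 3 * (2 : ℝ) ^ m := by
  have h1 : ∃ x, e x = true := by
    by_contra hne
    push Not at hne
    apply hn2
    have he : e = fun _ => false := funext fun x => by simpa using hne x
    rw [he]
    exact isDegLeFun_const 2 false
  have h0 : ∃ x, e x = false := by
    by_contra hne
    push Not at hne
    apply hn2
    have he : e = fun _ => true := funext fun x => by simpa using hne x
    rw [he]
    exact isDegLeFun_const 2 true
  have hb := fc_bias (stub_rmWeight stub_derivDegree) h3 h1 h0
  linarith

/-! ### Correlation with the spectrum of a bent slice -/

/-- **Separation bound for one fibre.** If `Wv = A·(-1)^{d}` with `A ≥ 0` (the Walsh spectrum of a bent slice with dual `d`)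
and `p ⊕ d` has degree exactly three (the cubic parts of `p` and `d` differ), then
`4·Σ_c (-1)^{p(c)} Wv(c) ≤ 3·A·2^m`. [folklore] -/
theorem corr_le_three_quarters (p d : (Fin m → Bool) → Bool) (Wv : (Fin m → Bool) → ℝ) (A : ℝ) (hA : 0 ≤ A)
    (hW : ∀ c, Wv c = A * signOf (d c))
    (h3 : IsDegLeFun 3 (fun c => p c ^^ d c)) (hn2 : ¬ IsDegLeFun 2 (fun c => p c ^^ d c)) :
    4 * ∑ c, signOf (p c) * Wv c ≤ 3 * A * (2 : ℝ) ^ m := by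
  have h1 : ∑ c, signOf (p c) * Wv c = A * ∑ c, signOf (p c ^^ d c) := by
    rw [mul_sum]
    refine sum_congr rfl fun c _ => ?_
    rw [hW c, signOf_xor]; ring
  rw [h1]
  have hb := abs_sum_signOf_le (fun c => p c ^^ d c) h3 hn2
  have hle : ∑ c, signOf (p c ^^ d c) ≤ |∑ c, signOf (p c ^^ d c)| := le_abs_self _
  nlinarith

/-- **Separation bound summed over the fibres** (the form matching `Negative.ShapeLemma.fsum_eq_fibreSigned`): if every
`c`-slice `c ↦ F b c` differs from the dual `d` by an exact-degree-three word, then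
`4·Σ_c Wv(c)·Σ_b (-1)^{F b c} ≤ 3·A·2^m·2^s`. [folklore] -/
theorem fibreSum_corr_le {s : ℕ} (F : (Fin s → Bool) → (Fin m → Bool) → Bool) (d : (Fin m → Bool) → Bool)
    (Wv : (Fin m → Bool) → ℝ) (A : ℝ) (hA : 0 ≤ A) (hW : ∀ c, Wv c = A * signOf (d c))
    (h3 : ∀ b, IsDegLeFun 3 (fun c => F b c ^^ d c)) (hn2 : ∀ b, ¬ IsDegLeFun 2 (fun c => F b c ^^ d c)) :
    4 * ∑ c, Wv c * ∑ b, signOf (F b c) ≤ 3 * A * (2 : ℝ) ^ m * (2 : ℝ) ^ s := by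
  have hswap : ∑ c, Wv c * ∑ b, signOf (F b c) = ∑ b, ∑ c, signOf (F b c) * Wv c := by
    simp_rw [mul_sum]
    rw [sum_comm]
    refine sum_congr rfl fun b _ => sum_congr rfl fun c _ => ?_
    ring
  rw [hswap, mul_sum]
  have hcard : ((univ : Finset (Fin s → Bool)).card : ℝ) = (2 : ℝ) ^ s := by
    rw [card_univ, Fintype.card_fun, Fintype.card_bool, Fintype.card_fin]; push_cast; ring
  calc ∑ b, 4 * ∑ c, signOf (F b c) * Wv c ≤ ∑ _b : Fin s → Bool, 3 * A * (2 : ℝ) ^ m :=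
        sum_le_sum fun b _ => corr_le_three_quarters (F b) d Wv A hA hW (h3 b) (hn2 b)
    _ = 3 * A * (2 : ℝ) ^ m * (2 : ℝ) ^ s := by rw [sum_const, nsmul_eq_mul, hcard]; ring

/-- **Matched-slice bound** (trivial companion, for bookkeeping in the census): with `|Wv| ≤ A` pointwise,
`Σ_c Wv(c)·Σ_b (-1)^{F b c} ≤ A·2^m·2^s`. [folklore] -/
theorem fibreSum_corr_le_trivial {s : ℕ} (F : (Fin s → Bool) → (Fin m → Bool) → Bool)
    (Wv : (Fin m → Bool) → ℝ) (A : ℝ) (hW : ∀ c, |Wv c| ≤ A) :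
    ∑ c, Wv c * ∑ b, signOf (F b c) ≤ A * (2 : ℝ) ^ m * (2 : ℝ) ^ s := by
  have hb : ∀ c : Fin m → Bool, Wv c * ∑ b, signOf (F b c) ≤ A * (2 : ℝ) ^ s := by
    intro c
    refine (le_abs_self _).trans ?_
    rw [abs_mul]
    have h2 : |∑ b, signOf (F b c)| ≤ (2 : ℝ) ^ s := by
      refine (abs_sum_le_sum_abs _ _).trans ?_
      have : ∑ b : Fin s → Bool, |signOf (F b c)| = (2 : ℝ) ^ s := by
        simp_rw [abs_signOf]
        rw [sum_const, card_univ, Fintype.card_fun, Fintype.card_bool, Fintype.card_fin]; simp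
      rw [this]
    have hA : 0 ≤ A := (abs_nonneg _).trans (hW c)
    exact mul_le_mul (hW c) h2 (abs_nonneg _) hA
  calc ∑ c, Wv c * ∑ b, signOf (F b c) ≤ ∑ _c : Fin m → Bool, A * (2 : ℝ) ^ s := sum_le_sum fun c _ => hb c
    _ = A * (2 : ℝ) ^ m * (2 : ℝ) ^ s := by
        rw [sum_const, card_univ, Fintype.card_fun, Fintype.card_bool, Fintype.card_fin, nsmul_eq_mul]
        push_cast; ring

end Summit.QuantumAdvantage.QuantumAdvantage.Theorems.NearExactIsExact.Negative.CubicPartSeparation
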